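import Summits.Ventures.WeilGRH.UniformConductorFloorJointFloorsLog9
import Summits.Ventures.WeilGRH.UniformConductorFloorJointEvenLog11Check
import Summits.Ventures.WeilGRH.UniformConductorFloorJointEvenLog11CheckB
import Summits.Ventures.WeilGRH.UniformConductorFloorJointOddLog11Check
import Summits.Ventures.WeilGRH.UniformConductorFloorJointOddLog11CheckB
import Summits.Ventures.WeilGRH.UniformConductorFloorCellsOne
import Summits.Ventures.WeilGRH.UniformConductorFloorRungs
import HarnessLib

/-!
# GRH arm (rh-explicit, venture WeilGRH): ★ the rung `t = (log 11)/2` for EVERY Dirichlet character of EVERY modulus `q ≥ 228` (odd characters: `q ≥ 78`) — the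
  joint cell certificates

Cell `rh-explicit`, WEIL TRACK — GRH ARM (weil-grh-1, gen9).  The uniform conductor floor at the fifth rung `t = (log 11)/2` (prime powers `2, 3, 4, 5, 7, 8, 9` inside
the window), from `certEvenLog11` / `certOddLog11` (`UniformConductorFloorJointDataLog11.lean`; `R = 320`, `J = 384`, `t = 384 log(320/319) = 1.201879 ≥ (log 11)/2 = 1.198948`,
`N = 11` — the grid window overshoots `e^{2t} = 11.07`, so the weight table carries `0` at `10` and a genuine weight at the prime `11`),
kernel-checked in `…Joint{Even,Odd}Log11Check(B).lean`, through `JointCert.weilPositivityOnChar_of_parts`: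

* ★ `weilPositivityOnChar_log11half_of_ge_228` — EVERY Dirichlet character of EVERY modulus `q ≥ 228` satisfies `WeilPositivityOnChar χ ((log 11)/2)`;
* ★ `weilPositivityOnChar_log11half_of_odd_ge_78` — every ODD character of every modulus `q ≥ 78`.

With the flat-window failures at this rung (`UniformConductorFloorPrincipalLog11.lean`: every prime `p ≤ 199`) and the 16-mode witness for `211`
(`UniformConductorFloorPrincipalMod211Log11.lean`) the PRIME statement at `(log 11)/2` reads «`p ≤ 211` fails, `p ≥ 229` holds», the primes `223` and `227`
(32-mode Galerkin bottom `214.16`: both expected TRUE, door cells of margins ≈ `0.04` / `0.06` on a `(log 11)/2` table) being open.  Inputs: the standard weights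
padded to `N = 11` (`hw_of_weights11`: `Λ(10) = 0`, `Λ(11)/√11 ≤ 785698/2^20` from `log 11 < 2 log 2 + log 3` and `√11 ≥ 3.3166`), `psi_even_ge` / `psi_odd_ge`,
`log 228 ≥ 5 log 3 − 15/228`, `log 78 ≥ 4 log 3 − 3/78`, and `11·319^768 ≤ 320^768` for the window.  Method floors 227.33 / 77.50; no `ζ` input; standard axioms.

## References

* A. Weil (1952), (11) pp. 261–262 and the «lemme» p. 262 [Weil1952FormulesExplicites]; L. Collatz (1942) / H. Wielandt (1950). [folklore]
-/

noncomputable section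

open Real Set
open scoped ArithmeticFunction.vonMangoldt

namespace Summit.Ventures.WeilGRH

open Literature.NumberTheory.LFunctions

namespace UniformFloor

variable {q : ℕ}

/-! ## Inputs -/

/-- `Λ(11)/√11 = log 11/√11 ≤ 785698/2^20` (`log 11 < log 12 = 2 log 2 + log 3 < 2.48490666`, `√11 ≥ 3.3166`). [folklore] -/
theorem vonMangoldt_eleven_div_sqrt_le : (Λ 11 : ℝ) / Real.sqrt ((11 : ℕ) : ℝ) ≤ ((785698 : ℕ) : ℝ) / ((1048576 : ℕ) : ℝ) := by
  have h11 : (Λ 11 : ℝ) = Real.log 11 := by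
    rw [ArithmeticFunction.vonMangoldt_apply_prime (by norm_num : Nat.Prime 11)]
    norm_num
  have hs : (3.3166 : ℝ) ≤ Real.sqrt ((11 : ℕ) : ℝ) := by
    rw [show ((11 : ℕ) : ℝ) = 11 by norm_num]
    exact Real.le_sqrt_of_sq_le (by norm_num)
  have hlog : Real.log 11 ≤ 2 * Real.log 2 + Real.log 3 := by
    rw [show (2 : ℝ) * Real.log 2 + Real.log 3 = Real.log 12 by
      rw [show (12 : ℝ) = 2 ^ 2 * 3 by norm_num, Real.log_mul (by norm_num) (by norm_num), Real.log_pow]; push_cast; ring]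
    exact Real.log_le_log (by norm_num) (by norm_num)
  have h2 := Real.log_two_lt_d9
  have h3 := Real.log_three_lt_d9
  have hpos : 0 ≤ Real.log 11 := Real.log_nonneg (by norm_num)
  rw [h11, div_le_iff₀ (lt_of_lt_of_le (by norm_num) hs)]
  push_cast
  nlinarith

/-- The weights of a `JointCert` with the standard table padded to `N = 11` (weight `0` at the non-prime-power `10`, `785698` at the prime `11`) dominate `Λ(n)/√n`.
[folklore] -/
theorem hw_of_weights11 (c : JointCert) (hN : c.N = 11) (hD : c.D = 1048576)
    (hW : c.weights = [0, 0, 513950, 665112, 363409, 754726, 0, 771213, 256975, 383993, 0, 785698]) :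
    ∀ n ∈ Finset.range (c.N + 1), (Λ n : ℝ) / Real.sqrt n ≤ c.wbar n := by
  intro n hn
  rw [hN] at hn
  have hn12 : n < 12 := by simpa using Finset.mem_range.1 hn
  unfold JointCert.wbar
  rw [hD, hW]
  have h7 : ∀ m < 8, (Λ m : ℝ) / Real.sqrt m ≤ wbar7 m := fun m hm ↦
    wbar7_ge 7 le_rfl m (Finset.mem_range.2 (by omega))
  interval_cases n
  · exact (h7 0 (by norm_num)).trans (by norm_num [wbar7])
  · exact (h7 1 (by norm_num)).trans (by norm_num [wbar7])
  · exact (h7 2 (by norm_num)).trans (by norm_num [wbar7])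
  · exact (h7 3 (by norm_num)).trans (by norm_num [wbar7])
  · exact (h7 4 (by norm_num)).trans (by norm_num [wbar7])
  · exact (h7 5 (by norm_num)).trans (by norm_num [wbar7])
  · exact (h7 6 (by norm_num)).trans (by norm_num [wbar7])
  · exact (h7 7 (by norm_num)).trans (by norm_num [wbar7])
  · simpa using vonMangoldt_eight_div_sqrt_le
  · simpa using vonMangoldt_nine_div_sqrt_le
  · have h10 : (Λ 10 : ℝ) = 0 := by
      rw [ArithmeticFunction.vonMangoldt_eq_zero_iff.mpr (by decide : ¬ IsPrimePow 10)]
    rw [h10]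
    norm_num
  · simpa using vonMangoldt_eleven_div_sqrt_le

/-- `(log 11)/2 ≤ 384 log(320/319)` (`11·319^768 ≤ 320^768`). [folklore] -/
theorem log11half_le_t (c : JointCert) (hR : c.R = 320) (hJ : c.J = 384) : Real.log 11 / 2 ≤ c.t := by
  rw [JointCert.t_eq_log, hR, hJ]
  have h : Real.log 11 ≤ Real.log (((((320 : ℕ) : ℝ) / (((320 : ℕ) : ℝ) - 1)) ^ 384) ^ 2) := by
    refine Real.log_le_log (by norm_num) ?_
    rw [← pow_mul, div_pow, le_div_iff₀ (by norm_num)]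
    have h0 : (11 : ℝ) * 319 ^ 768 ≤ 320 ^ 768 := by exact_mod_cast (by decide +kernel : 11 * 319 ^ 768 ≤ 320 ^ 768)
    norm_num
    exact h0
  rw [Real.log_pow] at h
  push_cast at h ⊢
  linarith

/-- The budget of `certEvenLog11`: `log π − (−4.22745354) − Clow/D + RHO/D = 5.426400 ≤ log 228` (`log 228 ≥ 5 log 3 − 15/228 = 5.427272`).
[folklore] -/
theorem certEvenLog11_budget :
    Real.log Real.pi - (-4.22745354) - (certEvenLog11.Clow : ℝ) / certEvenLog11.D + (certEvenLog11.RHO : ℝ) / certEvenLog11.D ≤ Real.log (228 : ℕ) := by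
  have hπ := Literature.Analysis.SpecialFunctions.Real.log_pi_le
  have h3 := Real.log_three_gt_d9
  have hl : Real.log ((243 : ℝ) / 228) ≤ 243 / 228 - 1 := Real.log_le_sub_one_of_pos (by norm_num)
  have hS : Real.log (243 : ℝ) = 5 * Real.log 3 := by
    rw [show (243 : ℝ) = 3 ^ 5 by norm_num, Real.log_pow]
    push_cast
    ring
  rw [Real.log_div (by norm_num) (by norm_num), hS] at hl
  rw [show certEvenLog11.Clow = 7676641 from rfl, show certEvenLog11.D = 1048576 from rfl, show certEvenLog11.RHO = 7733491 from rfl]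
  push_cast at *
  linarith

/-- The budget of `certOddLog11`: `… = 4.350216 ≤ log 78` (`log 78 ≥ 4 log 3 − 3/78 = 4.355988`). [folklore] -/
theorem certOddLog11_budget :
    Real.log Real.pi - (-1.08586154) - (certOddLog11.Clow : ℝ) / certOddLog11.D + (certOddLog11.RHO : ℝ) / certOddLog11.D ≤ Real.log (78 : ℕ) := by
  have hπ := Literature.Analysis.SpecialFunctions.Real.log_pi_le
  have h3 := Real.log_three_gt_d9
  have hl : Real.log ((81 : ℝ) / 78) ≤ 81 / 78 - 1 := Real.log_le_sub_one_of_pos (by norm_num)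
  have hS : Real.log (81 : ℝ) = 4 * Real.log 3 := by
    rw [show (81 : ℝ) = 3 ^ 4 by norm_num, Real.log_pow]
    push_cast
    ring
  rw [Real.log_div (by norm_num) (by norm_num), hS] at hl
  rw [show certOddLog11.Clow = 4399981 from rfl, show certOddLog11.D = 1048576 from rfl, show certOddLog11.RHO = 6622568 from rfl]
  push_cast at *
  linarith

/-! ## The cells, reassembled from the two kernel ranges -/

/-- All `384` cells of `certEvenLog11`. [folklore] -/
theorem certEvenLog11_cells : ∀ j < certEvenLog11.J, certEvenLog11.cellOKB j = true := by
  intro j hj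
  have hJ : certEvenLog11.J = 384 := rfl
  by_cases h : j < 192
  · exact certEvenLog11.cellsLoop_spec 192 0 (by omega) certEvenLog11_cellsA j (Nat.zero_le _) (by omega)
  · exact certEvenLog11.cellsLoop_spec 192 192 (by omega) certEvenLog11_cellsB j (by omega) (by omega)

/-- All `384` cells of `certOddLog11`. [folklore] -/
theorem certOddLog11_cells : ∀ j < certOddLog11.J, certOddLog11.cellOKB j = true := by
  intro j hj
  have hJ : certOddLog11.J = 384 := rfl
  by_cases h : j < 192
  · exact certOddLog11.cellsLoop_spec 192 0 (by omega) certOddLog11_cellsA j (Nat.zero_le _) (by omega)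
  · exact certOddLog11.cellsLoop_spec 192 192 (by omega) certOddLog11_cellsB j (by omega) (by omega)

/-! ## The floors -/

/-- ★ Every EVEN character of every modulus `q ≥ 228` at the rung `(log 11)/2`. [folklore] -/
theorem weilPositivityOnChar_log11half_of_even_ge_228 (hq : 228 ≤ q) (χ : DirichletCharacter ℂ q) (hpar : charParity χ = 0) :
    WeilPositivityOnChar χ (Real.log 11 / 2) := by
  have h := certEvenLog11.weilPositivityOnChar_of_parts certEvenLog11_checkFrame certEvenLog11_cells
    (hw_of_weights11 certEvenLog11 rfl rfl rfl) psi_even_ge (Q₀ := 228) (by norm_num) certEvenLog11_budget (by omega) hq χ hpar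
  have ht := log11half_le_t certEvenLog11 rfl rfl
  exact fun g hg hsupp ↦ h g hg (hsupp.trans (Icc_subset_Icc (by linarith) ht))

/-- ★ Every ODD character of every modulus `q ≥ 78` at the rung `(log 11)/2`. [cite: Weil1952FormulesExplicites, (11) and the «lemme» p. 262] -/
theorem weilPositivityOnChar_log11half_of_odd_ge_78 (hq : 78 ≤ q) (χ : DirichletCharacter ℂ q) (hpar : charParity χ = 1) :
    WeilPositivityOnChar χ (Real.log 11 / 2) := by
  have h := certOddLog11.weilPositivityOnChar_of_parts certOddLog11_checkFrame certOddLog11_cells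
    (hw_of_weights11 certOddLog11 rfl rfl rfl) psi_odd_ge (Q₀ := 78) (by norm_num) certOddLog11_budget (by omega) hq χ hpar
  have ht := log11half_le_t certOddLog11 rfl rfl
  exact fun g hg hsupp ↦ h g hg (hsupp.trans (Icc_subset_Icc (by linarith) ht))

/-- ★★ **EVERY Dirichlet character of EVERY modulus `q ≥ 228` satisfies Weil positivity on `[−(log 11)/2, (log 11)/2]`.**
[cite: Weil1952FormulesExplicites, (11) and the «lemme» p. 262] -/
theorem weilPositivityOnChar_log11half_of_ge_228 (hq : 228 ≤ q) (χ : DirichletCharacter ℂ q) : WeilPositivityOnChar χ (Real.log 11 / 2) := by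
  rcases Nat.le_one_iff_eq_zero_or_eq_one.1 (charParity_le_one χ) with h | h
  · exact weilPositivityOnChar_log11half_of_even_ge_228 hq χ h
  · exact weilPositivityOnChar_log11half_of_odd_ge_78 (by omega) χ h

/-- The same on every window `t ≤ (log 11)/2`. [folklore] -/
theorem weilPositivityOnChar_of_le_log11half_of_ge_228 (hq : 228 ≤ q) (χ : DirichletCharacter ℂ q) {t : ℝ} (ht : t ≤ Real.log 11 / 2) :
    WeilPositivityOnChar χ t := fun g hg hsupp ↦
  weilPositivityOnChar_log11half_of_ge_228 hq χ g hg (hsupp.trans (Icc_subset_Icc (by linarith) ht))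

end UniformFloor

end Summit.Ventures.WeilGRH

end
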